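import Summits.NavierStokesRegularity.NavierStokesRegularity.Theorems.HarmonicShellLineGlue
import HarnessLib

/-!
# IsotropicBlobSourceProfiles — the three zonal SOURCE profiles `F₀, F₂, F₄` of the ROUND-41 `C²` witness

Data of record: nsreg-p1 g33, `r42/f_zonal_k4.txt` (sha16 179f153d33cf3df6): inside the unit ball (`s = ‖x‖² ≤ 1`)
the pressure source of the witness field `witnessFieldC2` (envelope `(1−s)₊⁴`) is
`f = −tr((∇u)²) = F₀(s) + F₂(s)·Z₂(x) + F₄(s)·Z₄(x)` with the polynomials below; outside it is `0`.  This file fixes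
the NAMES the S-lane types against (LEAD plate map v3, 2026-08-28): `srcPoly0/2/4` (the interior polynomials),
`srcProfile0/2/4 := lineGlue 1 srcPoly_l 0` (glued to `0` on `s ≥ 1`; each `srcPoly_l` vanishes at `s = 1`), their
branch lemmas and values at `0` and `1`.  Consumers: the 1-D Poisson identities `4s·Φ_l″ + (4l+6)·Φ_l′ = srcProfile_l`
(pressure profiles, ns-s29-p2) and the trace identity `−tr((∇u)²) = Σ_l srcProfile_l(‖x‖²)·Z_l(x)` (field, ns-sfl-p1).
`--supports stmt-NavierStokesRegularity-0056 --as helper`.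
HONEST FRAME: explicit rational data of a kinematic slice witness; nothing about 0056 `NoTypeII` or NS regularity.
-/

set_option linter.dupNamespace false

open Set

namespace Summit.NavierStokesRegularity.NavierStokesRegularity.Theorems.StrainDoors

namespace IsotropicBlob

open HarmonicShell

noncomputable section

/-- support (definition): interior source profile `F₀(s)` (degree 8; r42/f_zonal_k4.txt). -/
def srcPoly0 (s : ℝ) : ℝ :=
  -3/2 + 28 * s - 2422/15 * s ^ 2 + 2196/5 * s ^ 3 - 649 * s ^ 4 + 1612/3 * s ^ 5 - 234 * s ^ 6
    + 204/5 * s ^ 7 + 19/30 * s ^ 8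

/-- support (definition): interior source profile `F₂(s)` (degree 7). -/
def srcPoly2 (s : ℝ) : ℝ :=
  4 - 692/21 * s + 732/7 * s ^ 2 - 1180/7 * s ^ 3 + 3100/21 * s ^ 4 - 468/7 * s ^ 5 + 12 * s ^ 6 + 4/21 * s ^ 7

/-- support (definition): interior source profile `F₄(s)` (degree 6). -/
def srcPoly4 (s : ℝ) : ℝ :=
  -344/35 + 2256/35 * s - 1224/7 * s ^ 2 + 1760/7 * s ^ 3 - 1416/7 * s ^ 4 + 432/5 * s ^ 5 - 536/35 * s ^ 6

/-- `F₀(1) = 0`. -/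
theorem srcPoly0_one : srcPoly0 1 = 0 := by norm_num [srcPoly0]
/-- `F₂(1) = 0`. -/
theorem srcPoly2_one : srcPoly2 1 = 0 := by norm_num [srcPoly2]
/-- `F₄(1) = 0`. -/
theorem srcPoly4_one : srcPoly4 1 = 0 := by norm_num [srcPoly4]
/-- `F₀(0) = −3/2` (`= Δp(0) = −|S|²`). -/
theorem srcPoly0_zero : srcPoly0 0 = -3/2 := by norm_num [srcPoly0]
/-- `F₂(0) = 4`. -/
theorem srcPoly2_zero : srcPoly2 0 = 4 := by norm_num [srcPoly2]
/-- `F₄(0) = −344/35`. -/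
theorem srcPoly4_zero : srcPoly4 0 = -344/35 := by norm_num [srcPoly4]

/-- support (definition): the glued source profile `F₀` (`srcPoly0` on `s ≤ 1`, `0` beyond). -/
def srcProfile0 : ℝ → ℝ := lineGlue 1 srcPoly0 (fun _ => 0)
/-- support (definition): the glued source profile `F₂`. -/
def srcProfile2 : ℝ → ℝ := lineGlue 1 srcPoly2 (fun _ => 0)
/-- support (definition): the glued source profile `F₄`. -/
def srcProfile4 : ℝ → ℝ := lineGlue 1 srcPoly4 (fun _ => 0)

/-- Inside: `srcProfile0 s = srcPoly0 s` for `s ≤ 1`. -/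
theorem srcProfile0_of_le {s : ℝ} (h : s ≤ 1) : srcProfile0 s = srcPoly0 s := lineGlue_of_le h
/-- Inside: `srcProfile2 s = srcPoly2 s` for `s ≤ 1`. -/
theorem srcProfile2_of_le {s : ℝ} (h : s ≤ 1) : srcProfile2 s = srcPoly2 s := lineGlue_of_le h
/-- Inside: `srcProfile4 s = srcPoly4 s` for `s ≤ 1`. -/
theorem srcProfile4_of_le {s : ℝ} (h : s ≤ 1) : srcProfile4 s = srcPoly4 s := lineGlue_of_le h

/-- Outside (closed): `srcProfile0 s = 0` for `1 ≤ s`. -/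
theorem srcProfile0_of_ge {s : ℝ} (h : 1 ≤ s) : srcProfile0 s = 0 :=
  lineGlue_of_ge (f := srcPoly0) (g := fun _ => 0) srcPoly0_one h
/-- Outside (closed): `srcProfile2 s = 0` for `1 ≤ s`. -/
theorem srcProfile2_of_ge {s : ℝ} (h : 1 ≤ s) : srcProfile2 s = 0 :=
  lineGlue_of_ge (f := srcPoly2) (g := fun _ => 0) srcPoly2_one h
/-- Outside (closed): `srcProfile4 s = 0` for `1 ≤ s`. -/
theorem srcProfile4_of_ge {s : ℝ} (h : 1 ≤ s) : srcProfile4 s = 0 :=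
  lineGlue_of_ge (f := srcPoly4) (g := fun _ => 0) srcPoly4_one h

/-- In terms of `‖x‖`: inside the closed unit ball, `srcProfile_l (‖x‖²) = srcPoly_l (‖x‖²)`. -/
theorem srcProfile_of_norm_le_one {E : Type*} [SeminormedAddCommGroup E] {x : E} (h : ‖x‖ ≤ 1) :
    srcProfile0 (‖x‖ ^ 2) = srcPoly0 (‖x‖ ^ 2) ∧ srcProfile2 (‖x‖ ^ 2) = srcPoly2 (‖x‖ ^ 2) ∧
      srcProfile4 (‖x‖ ^ 2) = srcPoly4 (‖x‖ ^ 2) := by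
  have hs : ‖x‖ ^ 2 ≤ 1 := by nlinarith [norm_nonneg x]
  exact ⟨srcProfile0_of_le hs, srcProfile2_of_le hs, srcProfile4_of_le hs⟩

/-- In terms of `‖x‖`: outside the open unit ball, all three glued source profiles vanish at `‖x‖²`. -/
theorem srcProfile_of_one_le_norm {E : Type*} [SeminormedAddCommGroup E] {x : E} (h : 1 ≤ ‖x‖) :
    srcProfile0 (‖x‖ ^ 2) = 0 ∧ srcProfile2 (‖x‖ ^ 2) = 0 ∧ srcProfile4 (‖x‖ ^ 2) = 0 := by
  have hs : 1 ≤ ‖x‖ ^ 2 := by nlinarith [norm_nonneg x]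
  exact ⟨srcProfile0_of_ge hs, srcProfile2_of_ge hs, srcProfile4_of_ge hs⟩

end

end IsotropicBlob

end Summit.NavierStokesRegularity.NavierStokesRegularity.Theorems.StrainDoors
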